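import Mathlib
import HarnessLib

/-!
# S1a — R4e preliminaries: TRANSLATION RECOORDINATION `x₁ ↦ x₁ + α`, `x₂ ↦ x₂ + β` and the RECENTRED GRAPH TAIL

[OURS · L1 W4.5c · lead-1 g16; plan-1 RULING R-F15p ★ R4e-rational `graphTail_killsIn_two` — per critical point `αᵢ` of `g` the local R4 normal form is obtained from the
global one `σ: x₁ ↦ x₁ + x₀, x₃ ↦ x₃ + (x₂ − g(x₁))` by the translation `x₁ ↦ x₁ + αᵢ`, `x₂ ↦ x₂ + g(αᵢ)` (pattern ✓`FreeModel.exists_affineRecoord_parabola`)] — NOT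
statements of the manuscript; counted 0; AI-level work, weaker than expert review. Crux stmt-ResolutionOfSingularities-17941 `CyclicQuotientFourfolds`, line
`s1a-logminvertex` v13 (`stub_reachLowerInFX`).

* `FreeModel.exists_affineRecoord_translate` — the `k`-algebra automorphism `γ` of `k[x₀..x₃]` with `γx₁ = x₁ + α`, `γx₂ = x₂ + β`, `γx₀ = x₀`, `γx₃ = x₃`, and its inverse;
* ★ `FreeModel.exists_graph_recentre` — for `σ` with rows `x₀ ↦ x₀`, `x₁ ↦ x₁ + x₀`, `x₂ ↦ x₂`, `x₃ ↦ x₃ + (x₂ − g(x₁))` (`g : k[X]`) and `α : k`: the conjugate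
  `σ' = γ ∘ σ ∘ γ⁻¹` has the same rows with the RECENTRED tail `x₂ − gα(x₁)`, `gα = g ∘ (X + α) − g(α)` (`gα(0) = 0`), together with `γ` and its pins.
-/

set_option linter.dupNamespace false

noncomputable section

open MvPolynomial

namespace Summit.ResolutionOfSingularities.ResolutionOfSingularities.Theorems.WildQuotientResolution.S1.FreeModel

/-- **Translation of two coordinates** as a `k`-algebra automorphism of `k[x₀..x₃]`, with its inverse. [folklore] -/
theorem exists_affineRecoord_translate (k : Type) [Field k] (α β : k) :
    ∃ γ : MvPolynomial (Fin 4) k ≃ₐ[k] MvPolynomial (Fin 4) k, γ (X 0) = X 0 ∧ γ (X 1) = X 1 + C α ∧ γ (X 2) = X 2 + C β ∧ γ (X 3) = X 3 ∧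
      γ.symm (X 0) = X 0 ∧ γ.symm (X 1) = X 1 - C α ∧ γ.symm (X 2) = X 2 - C β ∧ γ.symm (X 3) = X 3 := by
  let F : Fin 4 → MvPolynomial (Fin 4) k := ![X 0, X 1 + C α, X 2 + C β, X 3]
  let G' : Fin 4 → MvPolynomial (Fin 4) k := ![X 0, X 1 - C α, X 2 - C β, X 3]
  let f : MvPolynomial (Fin 4) k →ₐ[k] MvPolynomial (Fin 4) k := aeval F
  let g : MvPolynomial (Fin 4) k →ₐ[k] MvPolynomial (Fin 4) k := aeval G'
  have hf0 : f (X 0) = X 0 := aeval_X F 0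
  have hf1 : f (X 1) = X 1 + C α := aeval_X F 1
  have hf2 : f (X 2) = X 2 + C β := aeval_X F 2
  have hf3 : f (X 3) = X 3 := aeval_X F 3
  have hg0 : g (X 0) = X 0 := aeval_X G' 0
  have hg1 : g (X 1) = X 1 - C α := aeval_X G' 1
  have hg2 : g (X 2) = X 2 - C β := aeval_X G' 2
  have hg3 : g (X 3) = X 3 := aeval_X G' 3
  have hfC : ∀ a : k, f (C a) = C a := fun a => f.commutes a
  have hgC : ∀ a : k, g (C a) = C a := fun a => g.commutes a
  have hfg : f.comp g = AlgHom.id k _ := by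
    refine algHom_ext fun l => ?_
    fin_cases l
    · change f (g (X 0)) = X 0; rw [hg0, hf0]
    · change f (g (X 1)) = X 1; rw [hg1, map_sub, hf1, hfC]; ring
    · change f (g (X 2)) = X 2; rw [hg2, map_sub, hf2, hfC]; ring
    · change f (g (X 3)) = X 3; rw [hg3, hf3]
  have hgf : g.comp f = AlgHom.id k _ := by
    refine algHom_ext fun l => ?_
    fin_cases l
    · change g (f (X 0)) = X 0; rw [hf0, hg0]
    · change g (f (X 1)) = X 1; rw [hf1, map_add, hg1, hgC]; ring
    · change g (f (X 2)) = X 2; rw [hf2, map_add, hg2, hgC]; ring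
    · change g (f (X 3)) = X 3; rw [hf3, hg3]
  exact ⟨AlgEquiv.ofAlgHom f g hfg hgf, hf0, hf1, hf2, hf3, hg0, hg1, hg2, hg3⟩

/-- ★ **RECENTRING THE GRAPH TAIL AT `x₁ = α`**: conjugating the R4 normal form `x₃ ↦ x₃ + (x₂ − g(x₁))` by the translation `x₁ ↦ x₁ + α`, `x₂ ↦ x₂ + g(α)` gives
the same normal form with the tail `x₂ − gα(x₁)`, `gα = g ∘ (X + α) − g(α)`. [OURS · L1 W4.5c · R4e] -/
theorem exists_graph_recentre (k : Type) [Field k] (σ : MvPolynomial (Fin 4) k ≃+* MvPolynomial (Fin 4) k) (hC : ∀ a : k, σ (C a) = C a)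
    (h0 : σ (X 0) = X 0) (h1 : σ (X 1) = X 1 + X 0) (h2 : σ (X 2) = X 2) (g : Polynomial k)
    (h3 : σ (X 3) = X 3 + (X 2 - Polynomial.aeval (X 1 : MvPolynomial (Fin 4) k) g)) (α : k) :
    ∃ (γ : MvPolynomial (Fin 4) k ≃ₐ[k] MvPolynomial (Fin 4) k) (σ' : MvPolynomial (Fin 4) k ≃+* MvPolynomial (Fin 4) k),
      (∀ x, σ' x = γ (σ (γ.symm x))) ∧
      γ (X 0) = X 0 ∧ γ (X 1) = X 1 + C α ∧ γ (X 2) = X 2 + C (g.eval α) ∧ γ (X 3) = X 3 ∧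
      γ.symm (X 0) = X 0 ∧ γ.symm (X 1) = X 1 - C α ∧ γ.symm (X 2) = X 2 - C (g.eval α) ∧ γ.symm (X 3) = X 3 ∧
      (∀ a : k, σ' (C a) = C a) ∧ σ' (X 0) = X 0 ∧ σ' (X 1) = X 1 + X 0 ∧ σ' (X 2) = X 2 ∧
      σ' (X 3) = X 3 + (X 2 - Polynomial.aeval (X 1 : MvPolynomial (Fin 4) k) (g.comp (Polynomial.X + Polynomial.C α) - Polynomial.C (g.eval α))) := by
  obtain ⟨γ, hγ0, hγ1, hγ2, hγ3, hγs0, hγs1, hγs2, hγs3⟩ := exists_affineRecoord_translate k α (g.eval α)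
  let σ' : MvPolynomial (Fin 4) k ≃+* MvPolynomial (Fin 4) k := (γ.symm.toRingEquiv.trans σ).trans γ.toRingEquiv
  have hσ' : ∀ x, σ' x = γ (σ (γ.symm x)) := fun _ => rfl
  have hγC : ∀ a : k, γ (C a) = C a := fun a => γ.commutes a
  have hγsC : ∀ a : k, γ.symm (C a) = C a := fun a => γ.symm.commutes a
  refine ⟨γ, σ', hσ', hγ0, hγ1, hγ2, hγ3, hγs0, hγs1, hγs2, hγs3, fun a => ?_, ?_, ?_, ?_, ?_⟩
  · rw [hσ', hγsC, hC, hγC]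
  · rw [hσ', hγs0, h0, hγ0]
  · rw [hσ', hγs1, map_sub, h1, hC, map_sub, map_add, hγ1, hγ0, hγC]; ring
  · rw [hσ', hγs2, map_sub, h2, hC, map_sub, hγ2, hγC]; ring
  · rw [hσ', hγs3, h3, map_add, map_sub, hγ3, hγ2]
    -- `γ (aeval (X 1) g) = aeval (X 1 + C α) g = aeval (X 1) (g.comp (X + C α))`
    have hγg : γ (Polynomial.aeval (X 1 : MvPolynomial (Fin 4) k) g) = Polynomial.aeval (X 1 + C α : MvPolynomial (Fin 4) k) g := by
      rw [← Polynomial.aeval_algHom_apply, hγ1]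
    have hcomp : Polynomial.aeval (X 1 : MvPolynomial (Fin 4) k) (g.comp (Polynomial.X + Polynomial.C α) - Polynomial.C (g.eval α)) =
        Polynomial.aeval (X 1 + C α : MvPolynomial (Fin 4) k) g - C (g.eval α) := by
      rw [map_sub, Polynomial.aeval_comp, map_add, Polynomial.aeval_X, Polynomial.aeval_C, Polynomial.aeval_C, MvPolynomial.algebraMap_eq]
    rw [hγg, hcomp]
    ring

end Summit.ResolutionOfSingularities.ResolutionOfSingularities.Theorems.WildQuotientResolution.S1.FreeModel

end
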